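import Literature.NumberTheory.LFunctions.Zhang2022.KnifeEdgeLenZDegreeTauTwoLowering

/-!
# Zhang (2022), rung F-S3 (Landau–Siegel programme, §D CHAIN #1 toeplitz closure squad): the REMAINDER LEG of the
# degree-2 lowering `conj τ₂ = −τ(χ)⁻¹·𝔖 + R₁` — `R₁ = o(𝔞𝔓)` by Cauchy–Schwarz + the repaired K0, hence
# «x₂ dark on a class» ⇐ K0-piece + «τ(χ)⁻¹·𝔖 dark on that class» (PROVED reductions; nothing asserted)

Y. Zhang, *Discrete mean estimates and the Landau–Siegel zero*, arXiv:2211.02515v1 [Zhang2022LandauSiegel] — an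
unrefereed manuscript under adjudication. **WHAT THIS IS NOT: not a claim about Theorems 1–2 of arXiv:2211.02515, about
Landau–Siegel zeros, or about Parity. The programme SEARCHES and TYPES; no claim about Landau–Siegel zeros, Theorems 1–2 of
arXiv:2211.02515 or a repaired Margin232 until a kernel theorem says so.** Every `theorem` below is algebra on top of TREE
THEOREMS (`KnifeEdge.crossCell_two_lowering`, `KnifeEdge.weights_nonneg_eventually`,
`KnifeEdge.discMean_profPoly_le_of_inClassMeanPiece`) and Mathlib's Cauchy–Schwarz `Real.sum_mul_le_sqrt_mul_sqrt`.
No `def`, no open `Prop`: the two OPEN inputs — the repaired K0 `KnifeEdge.InClassMeanPiece c′` (item stmt-Parity-20459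
`InClassSideTablesPiece`) and the darkness of the LOWERED main term `τ(χ)⁻¹·𝔖` on a pair class — are hypothesis BINDERS,
spelled inline, asserted by no one; every conclusion is exactly as open as they are.

## What this file does (ls-knife-toeplitz-typer-1 g3, cell `landau-siegel` §D, 2026-08-27; item (i) of the closing
## docstring of `KnifeEdge.crossCell_two_lowering` in `KnifeEdgeLenZDegreeTauTwoLowering` = DISPLAY #3
## (K1A-DISPLAY-3-Daudit.md) §1 (1a), the leg «`|R₁| ≤ C𝓛⁻¹⁰⁰·Σ𝔠*|Q_gH_f|ω` … closed by CS in the E-1 form + K0»)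

The tree theorem `KnifeEdge.crossCell_two_lowering` says: for every large `c′` there is `C` with, for all large `D` and
all pieces `g, f`, `‖conj(τ₂(g,f)) + τ(χ)⁻¹·𝔖(g,f)‖ ≤ C𝓛⁻¹⁰⁰·R(g,f)`, `R(g,f) := Σ_{(ψ,ρ)∈idx} Re 𝔠*·|Q_g(ρ)H_f(ρ)|·Re ω`.

* Part 1 — **WEIGHTED CAUCHY–SCHWARZ FOR THE REMAINDER** (Lemma 2.3 / Prop. 2.2 (i): the weights `Re 𝔠*·Re ω` are
  `≥ 0` on the index set): for ANY two tables `F, G`, `Σ Re 𝔠*·|F·G|·Re ω ≤ √(Ξ(F)·Ξ(G))`, `Ξ = KnifeEdge.discMean`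
  (`sum_weights_norm_mul_le_sqrt`).
* Part 2 — **`R₁ = o(𝔞𝔓)` GIVEN THE REPAIRED K0 AT `c′`:** for in-class pieces `f, g` (`KnifeEdge.InClassPiece`),
  `InClassMeanPiece c′` gives `Ξ(Q_g) ≤ (𝔅(g)+1)𝔞𝔓`, `Ξ(H_f) ≤ (𝔅(f)+1)𝔞𝔓` eventually under (A), so
  `C𝓛⁻¹⁰⁰·R(g,f) ≤ |C|·𝓛⁻¹⁰⁰·√((|𝔅(g)|+1)(|𝔅(f)|+1))·𝔞𝔓 ≤ ε𝔞𝔓` for `𝓛 ≥ 𝓛₀(ε, C, 𝔅(f), 𝔅(g))`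
  (`remainder_le_eps`); whence, for every large `c′`, GIVEN `InClassMeanPiece c′`:
  `‖conj(τ₂(g,f)) + τ(χ)⁻¹·𝔖(g,f)‖ ≤ ε𝔞𝔓` eventually under (A), for every in-class pair and every `ε > 0`
  (`crossCell_two_add_lowered_le_eps`, `crossCell_two_add_lowered_eventually`).
* Part 3 — **THE REDUCTION, class-generic** (`𝒞 : KnifeEdge.PairClass`), at one `c′ ≥ c₀` and eventually in `c′`:
  `InClassMeanPiece c′` ∧ ⟨`τ(χ)⁻¹·𝔖` dark on `𝒞` at `c′`⟩ ⇒ `CrossTablePsiOn c′ 𝒞 2 0`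
  (`crossTablePsiOn_two_zero_of_lowered_at`, `crossTablePsiOn_two_zero_eventually_of_lowered`). Here
  ⟨`τ(χ)⁻¹·𝔖` dark on `𝒞` at `c′`⟩ is the binder
  `∀ f f′ g g′, InClassPiece f f′ → InClassPiece g g′ → 𝒞 f f′ g g′ → ∀ ε > 0, ForAllLarge fun D _ χ => AssumptionA D χ →
  ‖(GammaFactor.tau χ)⁻¹ * tauTwoLoweredSum c′ χ g f‖ ≤ ε * frakA χ * frakP D` — OPEN, asserted by no one: it is the
  port's x₂ input RENAMED (not discharged; (A)-guarded, `ε` before `ForAllLarge`, so irrefutable-as-typed), and it is the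
  object DISPLAY #3 §§2–4 evaluates (Lemma 8.1 + Prop. 7.1 for the D-shifted data `a₁ = D·δ_D ⋆ (υ1_{≤D⁴} ⋆ χg ⋆ χf)`,
  `a₂ = ν1_{<D⁴}`, and the crude bound `|S_j| ≤ D^{o(1)}`), none of which is done here.
* Part 4 — **THE COMPOSED PORTS** over `KnifeEdgeLenZDegreeShortPolyBinom`'s binomial reduction, token-for-token in the
  shape of the Summits port of stmt-Parity-20429 (`Theorems/ZDegreeToeplitzBandShortPairsTauTwoDarkOfPolyPiece`):
  `InClassSideTablesPiece` (`∃ c₀, ∀ c′ ≥ c₀, InClassMeanPiece c′`) + ⟨`τ(χ)⁻¹·𝔖` dark on `BinomShortPairs`, for all large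
  `c′`, allowed to use `InClassMeanPiece c′`⟩ ⇒ `∃ c₀, ∀ c′ ≥ c₀, TauTwoDarkShort c′`
  (`tauTwoDarkShort_eventually_of_lowered_binom_piece`); and the same with the lowered darkness taken on ALL short pairs
  (`tauTwoDarkShort_eventually_of_lowered_short_piece` — DISPLAY #3 §5's proposition is stated for all bounded short
  pieces, no smoothness).

EFFECT (bookkeeping; RENAMES, does not discharge): the x₂ input of port stmt-Parity-20429 moves from «`τ₂` dark on
`BinomShortPairs`» to «`τ(χ)⁻¹·𝔖` dark on `BinomShortPairs`»; no darkness input is discharged; debt-neutral.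

Typer: ls-knife-toeplitz-typer-1 g3 (literature-prover), file-disjoint from ls-knife-K0-p1's K0/§8 files.

## References
* Y. Zhang, arXiv:2211.02515v1 (2022), §2 Lemma 2.3, Prop. 2.2 (i), (2.15)–(2.17) p. 5; §4 Lemma 4.8 p. 9; §7 Prop. 7.1
  (7.2) p. 13; §8 (8.2)–(8.5), Lemma 8.1, (8.23) p. 16–18; §15 p. 80.
  [cite: Zhang2022LandauSiegel, §8 (8.2)–(8.5) Lemma 8.1 p.16; §2 Lemma 2.3 p.5; §15 p.80]
-/

noncomputable section

open Complex Real ComplexConjugate Finset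

namespace Literature.NumberTheory.LFunctions.Zhang2022.KnifeEdge

open Repair Skeleton

/-- `⌈exp L₀⌉ ≤ D` gives `L₀ ≤ 𝓛`. [folklore] -/
private theorem le_ell_of_ceil_exp_le_rem {L₀ : ℝ} {D : ℕ} (hD : ⌈Real.exp L₀⌉₊ ≤ D) : L₀ ≤ ell D := by
  have h : Real.exp L₀ ≤ (D : ℝ) := (Nat.le_ceil _).trans (by exact_mod_cast hD)
  exact (Real.le_log_iff_exp_le (lt_of_lt_of_le (Real.exp_pos _) h)).mpr h

/-! ### Part 1 — weighted Cauchy–Schwarz for the remainder `Σ Re 𝔠*·|F·G|·Re ω` -/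

section CS

variable {c' : ℝ} {D : ℕ} {χ : DirichletCharacter ℂ D}

/-- **Weighted Cauchy–Schwarz for the remainder** (the «CS in the E-1 form» of DISPLAY #3 §1 (1a)): with the weights
`Re 𝔠*(ρ,ψ)·Re ω(ρ) ≥ 0` on the index set (Lemma 2.3 + Prop. 2.2 (i), (2.15)), for any two tables `F, G`,
`Σ_{(ψ,ρ)} Re 𝔠*·|F(ψ,ρ)G(ψ,ρ)|·Re ω ≤ √(Ξ(F)·Ξ(G))`, `Ξ = KnifeEdge.discMean` ((8.3)-shaped discrete means).
[cite: Zhang2022LandauSiegel, §2 Lemma 2.3, (2.15)–(2.17) p.5, §8 (8.2)–(8.3) p.16] -/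
theorem sum_weights_norm_mul_le_sqrt (hw : ∀ i ∈ idx χ, 0 ≤ (cstar c' D i.1 i.2).re * (omegaW D i.2).re)
    (F G : Chr D → ℂ → ℂ) :
    ∑ i ∈ idx χ, (cstar c' D i.1 i.2).re * ‖F i.1 i.2 * G i.1 i.2‖ * (omegaW D i.2).re
      ≤ Real.sqrt (discMean c' χ F * discMean c' χ G) := by
  have key : ∀ i ∈ idx χ, (cstar c' D i.1 i.2).re * ‖F i.1 i.2 * G i.1 i.2‖ * (omegaW D i.2).re
      = (Real.sqrt ((cstar c' D i.1 i.2).re * (omegaW D i.2).re) * ‖F i.1 i.2‖) *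
        (Real.sqrt ((cstar c' D i.1 i.2).re * (omegaW D i.2).re) * ‖G i.1 i.2‖) := by
    intro i hi
    have hs := Real.mul_self_sqrt (hw i hi)
    rw [norm_mul]
    calc (cstar c' D i.1 i.2).re * (‖F i.1 i.2‖ * ‖G i.1 i.2‖) * (omegaW D i.2).re
        = ((cstar c' D i.1 i.2).re * (omegaW D i.2).re) * ‖F i.1 i.2‖ * ‖G i.1 i.2‖ := by ring
      _ = (Real.sqrt ((cstar c' D i.1 i.2).re * (omegaW D i.2).re) *
            Real.sqrt ((cstar c' D i.1 i.2).re * (omegaW D i.2).re)) * ‖F i.1 i.2‖ * ‖G i.1 i.2‖ := by rw [hs]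
      _ = _ := by ring
  have e1 : ∑ i ∈ idx χ, (Real.sqrt ((cstar c' D i.1 i.2).re * (omegaW D i.2).re) * ‖F i.1 i.2‖) ^ 2
      = discMean c' χ F := by
    unfold discMean
    refine Finset.sum_congr rfl fun i hi => ?_
    rw [mul_pow, Real.sq_sqrt (hw i hi)]
    ring
  have e2 : ∑ i ∈ idx χ, (Real.sqrt ((cstar c' D i.1 i.2).re * (omegaW D i.2).re) * ‖G i.1 i.2‖) ^ 2
      = discMean c' χ G := by
    unfold discMean
    refine Finset.sum_congr rfl fun i hi => ?_
    rw [mul_pow, Real.sq_sqrt (hw i hi)]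
    ring
  rw [Finset.sum_congr rfl key]
  refine (Real.sum_mul_le_sqrt_mul_sqrt _ _ _).trans (le_of_eq ?_)
  rw [e1, e2, Real.sqrt_mul (discMean_nonneg hw F)]

/-- The remainder sum is `≥ 0` when the weights are. [cite: Zhang2022LandauSiegel, §2 Lemma 2.3, (2.15) p.5] -/
theorem sum_weights_norm_mul_nonneg (hw : ∀ i ∈ idx χ, 0 ≤ (cstar c' D i.1 i.2).re * (omegaW D i.2).re)
    (F G : Chr D → ℂ → ℂ) :
    0 ≤ ∑ i ∈ idx χ, (cstar c' D i.1 i.2).re * ‖F i.1 i.2 * G i.1 i.2‖ * (omegaW D i.2).re :=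
  Finset.sum_nonneg fun i hi => by
    have := hw i hi
    calc (0 : ℝ) = ((cstar c' D i.1 i.2).re * (omegaW D i.2).re) * 0 := by ring
      _ ≤ ((cstar c' D i.1 i.2).re * (omegaW D i.2).re) * ‖F i.1 i.2 * G i.1 i.2‖ :=
          mul_le_mul_of_nonneg_left (norm_nonneg _) this
      _ = _ := by ring

end CS

/-! ### Part 2 — `R₁ = o(𝔞𝔓)` given the repaired K0 at `c′` -/

section Remainder

variable {c' : ℝ}

/-- **The remainder is `o(𝔞𝔓)` GIVEN the repaired K0 at `c′`** (DISPLAY #3 §1 (1a), the R₁ leg): for in-class pieces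
`f, g`, any constant `C` and `ε > 0`, eventually in `D` under (A) and GIVEN the weight positivity at `D`:
`C·𝓛⁻¹⁰⁰·Σ Re 𝔠*·|Q_g(ρ)H_f(ρ)|·Re ω ≤ ε·𝔞𝔓`. Proof: Part 1 + `InClassMeanPiece c′` as the upper bounds
`Ξ(Q_g) ≤ (𝔅(g)+1)𝔞𝔓`, `Ξ(H_f) ≤ (𝔅(f)+1)𝔞𝔓` (`discMean_profPoly_le_of_inClassMeanPiece`, `η = 1`) and
`𝓛 ≥ max 1 (|C|·√((|𝔅(g)|+1)(|𝔅(f)|+1))/ε + 1)` — the threshold in `D` depends on `ε`, `C` and the class constants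
`𝔅(f) = mainTermForm f f′`, `𝔅(g) = mainTermForm g g′` of the two pieces, all bound BEFORE `D`. [cite: Zhang2022LandauSiegel, §2 Lemma 2.3 p.5, §7 Prop 7.1, §8 (8.2)–(8.5), (8.23) p.16–18] -/
theorem remainder_le_eps (hK0 : InClassMeanPiece c') {f f' g g' : ℝ → ℂ} (hf : InClassPiece f f')
    (hg : InClassPiece g g') (C : ℝ) {ε : ℝ} (hε : 0 < ε) :
    ForAllLarge fun D _ χ => AssumptionA D χ →
      (∀ i ∈ idx χ, 0 ≤ (cstar c' D i.1 i.2).re * (omegaW D i.2).re) →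
        C * (ell D ^ 100)⁻¹ * ∑ i ∈ idx χ, (cstar c' D i.1 i.2).re *
            ‖profPoly χ i.1 g (⌊bigP D⌋₊ + 1) i.2 * profPoly χ i.1 f (⌊bigP D⌋₊ + 1) i.2‖ * (omegaW D i.2).re
          ≤ ε * frakA χ * frakP D := by
  -- the constant `M = √((|𝔅(g)|+1)(|𝔅(f)|+1))` and the threshold `L₀`
  set Bg : ℝ := |mainTermForm g g'| + 1 with hBg
  set Bf : ℝ := |mainTermForm f f'| + 1 with hBf
  have hBg0 : 0 < Bg := by positivity
  have hBf0 : 0 < Bf := by positivity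
  set M : ℝ := Real.sqrt (Bg * Bf) with hM
  have hM0 : 0 ≤ M := Real.sqrt_nonneg _
  set L₀ : ℝ := max 1 (|C| * M / ε + 1) with hL₀
  have hL : ForAllLarge fun D _ _ => L₀ ≤ ell D :=
    ForAllLarge.of_le ⌈Real.exp L₀⌉₊ fun D _ _ hD _ _ => le_ell_of_ceil_exp_le_rem hD
  have h1 := discMean_profPoly_le_of_inClassMeanPiece hK0 hg one_pos
  have h2 := discMean_profPoly_le_of_inClassMeanPiece hK0 hf one_pos
  refine ((h1.and h2).and hL).mono ?_
  intro D _ χ _ _ hh hA hw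
  obtain ⟨⟨h1, h2⟩, hL⟩ := hh
  have hAP : 0 ≤ frakA χ * frakP D := mul_nonneg (frakA_nonneg χ) (frakP_nonneg D)
  -- the two K0 upper bounds, with `𝔅 + 1 ≤ |𝔅| + 1`
  have hXg : discMean c' χ (fun x t => profPoly χ x g (⌊bigP D⌋₊ + 1) t) ≤ Bg * (frakA χ * frakP D) :=
    (h1 hA).trans (mul_le_mul_of_nonneg_right (by rw [hBg]; linarith [le_abs_self (mainTermForm g g')]) hAP)
  have hXf : discMean c' χ (fun x t => profPoly χ x f (⌊bigP D⌋₊ + 1) t) ≤ Bf * (frakA χ * frakP D) :=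
    (h2 hA).trans (mul_le_mul_of_nonneg_right (by rw [hBf]; linarith [le_abs_self (mainTermForm f f')]) hAP)
  have hXg0 : 0 ≤ discMean c' χ (fun x t => profPoly χ x g (⌊bigP D⌋₊ + 1) t) := discMean_nonneg hw _
  have hXf0 : 0 ≤ discMean c' χ (fun x t => profPoly χ x f (⌊bigP D⌋₊ + 1) t) := discMean_nonneg hw _
  -- Cauchy–Schwarz: the remainder sum is `≤ M·𝔞𝔓`
  have hS := sum_weights_norm_mul_le_sqrt hw (fun x t => profPoly χ x g (⌊bigP D⌋₊ + 1) t)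
    (fun x t => profPoly χ x f (⌊bigP D⌋₊ + 1) t)
  have hSM : ∑ i ∈ idx χ, (cstar c' D i.1 i.2).re *
      ‖profPoly χ i.1 g (⌊bigP D⌋₊ + 1) i.2 * profPoly χ i.1 f (⌊bigP D⌋₊ + 1) i.2‖ * (omegaW D i.2).re
        ≤ M * (frakA χ * frakP D) := by
    refine hS.trans ?_
    have hprod : discMean c' χ (fun x t => profPoly χ x g (⌊bigP D⌋₊ + 1) t) *
        discMean c' χ (fun x t => profPoly χ x f (⌊bigP D⌋₊ + 1) t)
          ≤ (Bg * (frakA χ * frakP D)) * (Bf * (frakA χ * frakP D)) :=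
      mul_le_mul hXg hXf hXf0 (hXg0.trans hXg)
    calc Real.sqrt (discMean c' χ (fun x t => profPoly χ x g (⌊bigP D⌋₊ + 1) t) *
          discMean c' χ (fun x t => profPoly χ x f (⌊bigP D⌋₊ + 1) t))
        ≤ Real.sqrt ((Bg * (frakA χ * frakP D)) * (Bf * (frakA χ * frakP D))) := Real.sqrt_le_sqrt hprod
      _ = Real.sqrt ((Bg * Bf) * (frakA χ * frakP D) ^ 2) := by ring_nf
      _ = M * (frakA χ * frakP D) := by
          rw [Real.sqrt_mul (mul_nonneg hBg0.le hBf0.le), Real.sqrt_sq hAP]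
  have hS0 := sum_weights_norm_mul_nonneg hw (fun x t => profPoly χ x g (⌊bigP D⌋₊ + 1) t)
    (fun x t => profPoly χ x f (⌊bigP D⌋₊ + 1) t)
  -- the threshold: `𝓛 ≥ L₀ ≥ 1` and `𝓛¹⁰⁰ ≥ 𝓛 > |C|·M/ε`
  have hL1 : 1 ≤ ell D := le_trans (le_max_left _ _) hL
  have hℓpos : 0 < ell D := by linarith
  have hpow : ell D ≤ ell D ^ 100 := le_self_pow₀ hL1 (by norm_num)
  have hpow0 : 0 < ell D ^ 100 := pow_pos hℓpos _
  have hCM : |C| * M / ε + 1 ≤ ell D ^ 100 := le_trans (le_trans (le_max_right _ _) hL) hpow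
  have hCM' : |C| * M ≤ ε * ell D ^ 100 := by
    have : |C| * M / ε ≤ ell D ^ 100 := by linarith
    rw [div_le_iff₀ hε] at this
    linarith [this]
  -- assemble
  calc C * (ell D ^ 100)⁻¹ * ∑ i ∈ idx χ, (cstar c' D i.1 i.2).re *
        ‖profPoly χ i.1 g (⌊bigP D⌋₊ + 1) i.2 * profPoly χ i.1 f (⌊bigP D⌋₊ + 1) i.2‖ * (omegaW D i.2).re
      ≤ |C| * (ell D ^ 100)⁻¹ * ∑ i ∈ idx χ, (cstar c' D i.1 i.2).re *
        ‖profPoly χ i.1 g (⌊bigP D⌋₊ + 1) i.2 * profPoly χ i.1 f (⌊bigP D⌋₊ + 1) i.2‖ * (omegaW D i.2).re := by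
        gcongr
        exact le_abs_self C
    _ ≤ |C| * (ell D ^ 100)⁻¹ * (M * (frakA χ * frakP D)) := by
        gcongr
    _ = (|C| * M) * (ell D ^ 100)⁻¹ * (frakA χ * frakP D) := by ring
    _ ≤ (ε * ell D ^ 100) * (ell D ^ 100)⁻¹ * (frakA χ * frakP D) := by
        gcongr
    _ = ε * frakA χ * frakP D := by
        field_simp

/-- **`‖conj τ₂ + τ(χ)⁻¹·𝔖‖ ≤ ε·𝔞𝔓` GIVEN the lowering estimate and the weights at `c′` and the repaired K0 at `c′`** —
the at-one-`c′` form with the two world binders of `KnifeEdge.crossCell_two_lowering_of_weights` DISPLAYED (the lowering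
estimate with its constant `C`; the weight positivity), for in-class `f, g` and `ε > 0`, eventually under (A).
[cite: Zhang2022LandauSiegel, §2 Lemma 2.3 p.5, §4 Lemma 4.8 p.9, §8 (8.5) Lemma 8.1 p.16, §15 p.80] -/
theorem crossCell_two_add_lowered_le_eps {C : ℝ}
    (hlow : ForAllLarge fun D _ χ => ∀ g f : ℝ → ℂ,
      ‖conj (crossCell c' χ 2 g f) + (GammaFactor.tau χ)⁻¹ * tauTwoLoweredSum c' χ g f‖ ≤
        C * (ell D ^ 100)⁻¹ * ∑ i ∈ idx χ, (cstar c' D i.1 i.2).re *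
          ‖profPoly χ i.1 g (⌊bigP D⌋₊ + 1) i.2 * profPoly χ i.1 f (⌊bigP D⌋₊ + 1) i.2‖ * (omegaW D i.2).re)
    (hw : ForAllLarge fun D _ χ => ∀ i ∈ idx χ, 0 ≤ (cstar c' D i.1 i.2).re * (omegaW D i.2).re)
    (hK0 : InClassMeanPiece c') {f f' g g' : ℝ → ℂ} (hf : InClassPiece f f') (hg : InClassPiece g g')
    {ε : ℝ} (hε : 0 < ε) :
    ForAllLarge fun D _ χ => AssumptionA D χ →
      ‖conj (crossCell c' χ 2 g f) + (GammaFactor.tau χ)⁻¹ * tauTwoLoweredSum c' χ g f‖ ≤ ε * frakA χ * frakP D := by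
  refine (((remainder_le_eps hK0 hf hg C hε).and hlow).and hw).mono ?_
  intro D _ χ _ _ hh hA
  obtain ⟨⟨hR, hlow⟩, hw⟩ := hh
  exact (hlow g f).trans (hR hA hw)

/-- **For every large `c′`: GIVEN the repaired K0 at `c′`, `‖conj τ₂(g,f) + τ(χ)⁻¹·𝔖(g,f)‖ ≤ ε·𝔞𝔓` eventually under
(A)**, for every in-class pair and every `ε > 0` — the two world binders eliminated by the tree theorems
`KnifeEdge.crossCell_two_lowering` and `KnifeEdge.weights_nonneg_eventually`. This is DISPLAY #3 §1 (1a) with its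
remainder `R₁` closed: `conj τ₂ = −τ(χ)⁻¹·𝔖 + o(𝔞𝔓)` on in-class pairs, modulo K0. [cite: Zhang2022LandauSiegel, §2 Lemma 2.3, Prop. 2.2 (i) p.5, §4 Lemma 4.8 p.9, §8 (8.5) Lemma 8.1 (8.23) p.16–18, §15 p.80] -/
theorem crossCell_two_add_lowered_eventually : ∃ c₀ : ℝ, 0 ≤ c₀ ∧ ∀ c' : ℝ, c₀ ≤ c' → InClassMeanPiece c' →
    ∀ (f f' g g' : ℝ → ℂ), InClassPiece f f' → InClassPiece g g' → ∀ ε : ℝ, 0 < ε →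
      ForAllLarge fun D _ χ => AssumptionA D χ →
        ‖conj (crossCell c' χ 2 g f) + (GammaFactor.tau χ)⁻¹ * tauTwoLoweredSum c' χ g f‖ ≤
          ε * frakA χ * frakP D := by
  obtain ⟨c₁, h1, hlow⟩ := crossCell_two_lowering
  obtain ⟨c₂, h2, hw⟩ := weights_nonneg_eventually
  refine ⟨max c₁ c₂, le_trans h1 (le_max_left _ _), fun c' hc' hK0 f f' g g' hf hg ε hε => ?_⟩
  obtain ⟨C, hC⟩ := hlow c' (le_trans (le_max_left _ _) hc')
  exact crossCell_two_add_lowered_le_eps hC (hw c' (le_trans (le_max_right _ _) hc')) hK0 hf hg hε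

end Remainder

/-! ### Part 3 — the reduction: x₂ dark on `𝒞` ⇐ K0-piece + `τ(χ)⁻¹·𝔖` dark on `𝒞` -/

section Reduction

variable {c' : ℝ}

/-- **THE REDUCTION AT ONE `c′`, binders displayed** (class-generic): GIVEN the lowering estimate at `c′` (constant `C`),
the weight positivity at `c′`, the repaired K0 `InClassMeanPiece c′`, and the darkness of the LOWERED main term
`τ(χ)⁻¹·𝔖` on the in-class pairs of `𝒞` (OPEN — asserted by no one; spelled inline; it is the x₂ input RENAMED, not
discharged), the degree-2 ψ-graded cross slot is DARK on `𝒞`: `CrossTablePsiOn c′ 𝒞 2 0`. Proof: `‖τ₂‖ = ‖conj τ₂‖ ≤ ‖conj τ₂ + τ(χ)⁻¹𝔖‖ + ‖τ(χ)⁻¹𝔖‖ ≤ (ε/2 + ε/2)𝔞𝔓`.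
[cite: Zhang2022LandauSiegel, §2 Lemma 2.3 p.5, §4 Lemma 4.8 p.9, §8 (8.5) Lemma 8.1 p.16, §15 p.80] -/
theorem crossTablePsiOn_two_zero_of_lowered_at {𝒞 : PairClass} {C : ℝ}
    (hlow : ForAllLarge fun D _ χ => ∀ g f : ℝ → ℂ,
      ‖conj (crossCell c' χ 2 g f) + (GammaFactor.tau χ)⁻¹ * tauTwoLoweredSum c' χ g f‖ ≤
        C * (ell D ^ 100)⁻¹ * ∑ i ∈ idx χ, (cstar c' D i.1 i.2).re *
          ‖profPoly χ i.1 g (⌊bigP D⌋₊ + 1) i.2 * profPoly χ i.1 f (⌊bigP D⌋₊ + 1) i.2‖ * (omegaW D i.2).re)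
    (hw : ForAllLarge fun D _ χ => ∀ i ∈ idx χ, 0 ≤ (cstar c' D i.1 i.2).re * (omegaW D i.2).re)
    (hK0 : InClassMeanPiece c')
    (hdark : ∀ (f f' g g' : ℝ → ℂ), InClassPiece f f' → InClassPiece g g' → 𝒞 f f' g g' → ∀ ε : ℝ, 0 < ε →
      ForAllLarge fun D _ χ => AssumptionA D χ →
        ‖(GammaFactor.tau χ)⁻¹ * tauTwoLoweredSum c' χ g f‖ ≤ ε * frakA χ * frakP D) :
    CrossTablePsiOn c' 𝒞 2 (fun _ _ _ _ => 0) := by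
  rw [crossTablePsiOn_zero_iff]
  intro f f' g g' hf hg h𝒞 ε hε
  have hε2 : 0 < ε / 2 := by linarith
  refine ((crossCell_two_add_lowered_le_eps hlow hw hK0 hf hg hε2).and (hdark f f' g g' hf hg h𝒞 (ε / 2) hε2)).mono ?_
  intro D _ χ _ _ hh hA
  obtain ⟨hR, hM⟩ := hh
  have e : crossCell c' χ 2 g f = conj (conj (crossCell c' χ 2 g f) +
      (GammaFactor.tau χ)⁻¹ * tauTwoLoweredSum c' χ g f) - conj ((GammaFactor.tau χ)⁻¹ * tauTwoLoweredSum c' χ g f) := by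
    simp only [map_add, Complex.conj_conj]; ring
  calc ‖crossCell c' χ 2 g f‖
      = ‖conj (conj (crossCell c' χ 2 g f) + (GammaFactor.tau χ)⁻¹ * tauTwoLoweredSum c' χ g f) -
          conj ((GammaFactor.tau χ)⁻¹ * tauTwoLoweredSum c' χ g f)‖ := by rw [← e]
    _ ≤ ‖conj (conj (crossCell c' χ 2 g f) + (GammaFactor.tau χ)⁻¹ * tauTwoLoweredSum c' χ g f)‖ +
          ‖conj ((GammaFactor.tau χ)⁻¹ * tauTwoLoweredSum c' χ g f)‖ := norm_sub_le _ _
    _ = ‖conj (crossCell c' χ 2 g f) + (GammaFactor.tau χ)⁻¹ * tauTwoLoweredSum c' χ g f‖ +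
          ‖(GammaFactor.tau χ)⁻¹ * tauTwoLoweredSum c' χ g f‖ := by rw [Complex.norm_conj, Complex.norm_conj]
    _ ≤ ε / 2 * frakA χ * frakP D + ε / 2 * frakA χ * frakP D := add_le_add (hR hA) (hM hA)
    _ = ε * frakA χ * frakP D := by ring

/-- **THE REDUCTION, eventually in `c′`** (class-generic; the shape the ports consume): if for all large `c′` the repaired
K0 at `c′` yields the darkness of the lowered main term `τ(χ)⁻¹·𝔖` on the in-class pairs of `𝒞` (OPEN input, inline),
then for all large `c′` the repaired K0 at `c′` yields `CrossTablePsiOn c′ 𝒞 2 0` — the world binders are supplied by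
`KnifeEdge.crossCell_two_lowering` and `KnifeEdge.weights_nonneg_eventually`. [cite: Zhang2022LandauSiegel, §2 Lemma 2.3, Prop. 2.2 (i) p.5, §4 Lemma 4.8 p.9, §8 (8.5) Lemma 8.1 p.16, §15 p.80] -/
theorem crossTablePsiOn_two_zero_eventually_of_lowered {𝒞 : PairClass}
    (hdark : ∃ c₀ : ℝ, ∀ c' : ℝ, c₀ ≤ c' → InClassMeanPiece c' →
      ∀ (f f' g g' : ℝ → ℂ), InClassPiece f f' → InClassPiece g g' → 𝒞 f f' g g' → ∀ ε : ℝ, 0 < ε →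
        ForAllLarge fun D _ χ => AssumptionA D χ →
          ‖(GammaFactor.tau χ)⁻¹ * tauTwoLoweredSum c' χ g f‖ ≤ ε * frakA χ * frakP D) :
    ∃ c₀ : ℝ, ∀ c' : ℝ, c₀ ≤ c' → InClassMeanPiece c' → CrossTablePsiOn c' 𝒞 2 (fun _ _ _ _ => 0) := by
  obtain ⟨c₁, _, hlow⟩ := crossCell_two_lowering
  obtain ⟨c₂, _, hw⟩ := weights_nonneg_eventually
  obtain ⟨c₃, hd⟩ := hdark
  refine ⟨max c₁ (max c₂ c₃), fun c' hc' hK0 => ?_⟩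
  have hc1 : c₁ ≤ c' := le_trans (le_max_left _ _) hc'
  have hc2 : c₂ ≤ c' := le_trans (le_trans (le_max_left _ _) (le_max_right _ _)) hc'
  have hc3 : c₃ ≤ c' := le_trans (le_trans (le_max_right _ _) (le_max_right _ _)) hc'
  obtain ⟨C, hC⟩ := hlow c' hc1
  exact crossTablePsiOn_two_zero_of_lowered_at hC (hw c' hc2) hK0 (hd c' hc3 hK0)

end Reduction

/-! ### Part 4 — the composed ports for stmt-Parity-20429 (`ShortPairsTauTwoDark`) -/

section Ports

/-- **PORT (binomial family):** `InClassSideTablesPiece` (stmt-Parity-20459: `∃ c₀, ∀ c′ ≥ c₀, InClassMeanPiece c′`) +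
⟨for all large `c′`, the repaired K0 at `c′` gives the darkness of the LOWERED main term `τ(χ)⁻¹·𝔖` on the binomial short
pairs `KnifeEdge.BinomShortPairs`⟩ (OPEN, inline) ⇒ `∃ c₀, ∀ c′ ≥ c₀, CrossTablePsiOn c′ ShortPairs 2 0` — over
`crossTablePsiOn_short_zero_eventually_of_binom_piece` (sesquilinearity + Taylor at the kink + density + K0).
[cite: Zhang2022LandauSiegel, §2 Lemma 2.3 p.5, §4 Lemma 4.8 p.9, §7 Prop 7.1 (7.2) p.13, §8 (8.5) Lemma 8.1 Lemma 8.2 p.16, §15 p.80] -/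
theorem crossTablePsiOn_short_two_zero_eventually_of_lowered_binom_piece
    (hK0 : ∃ c₀ : ℝ, ∀ c' : ℝ, c₀ ≤ c' → InClassMeanPiece c')
    (hlow : ∃ c₀ : ℝ, ∀ c' : ℝ, c₀ ≤ c' → InClassMeanPiece c' →
      ∀ (f f' g g' : ℝ → ℂ), InClassPiece f f' → InClassPiece g g' → BinomShortPairs f f' g g' → ∀ ε : ℝ, 0 < ε →
        ForAllLarge fun D _ χ => AssumptionA D χ →
          ‖(GammaFactor.tau χ)⁻¹ * tauTwoLoweredSum c' χ g f‖ ≤ ε * frakA χ * frakP D) :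
    ∃ c₀ : ℝ, ∀ c' : ℝ, c₀ ≤ c' → CrossTablePsiOn c' ShortPairs 2 (fun _ _ _ _ => 0) :=
  crossTablePsiOn_short_zero_eventually_of_binom_piece hK0 (crossTablePsiOn_two_zero_eventually_of_lowered hlow)

/-- **PORT (binomial family), in the words of stmt-Parity-20429:** `InClassSideTablesPiece` + ⟨lowered darkness on
`BinomShortPairs` for all large `c′`, given the repaired K0 at `c′`⟩ ⇒ `∃ c₀, ∀ c′ ≥ c₀, TauTwoDarkShort c′` — the statement
of `ShortPairsTauTwoDark` modulo its two open inputs, the darkness input now on the LOWERED main term of one explicit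
family (compare `tauTwoDarkShort_eventually_of_binom_piece`). [cite: Zhang2022LandauSiegel, §2 Lemma 2.3 p.5, §4 Lemma 4.8 p.9, §8 (8.5) Lemma 8.1 Lemma 8.2 p.16, §15 p.80] -/
theorem tauTwoDarkShort_eventually_of_lowered_binom_piece
    (hK0 : ∃ c₀ : ℝ, ∀ c' : ℝ, c₀ ≤ c' → InClassMeanPiece c')
    (hlow : ∃ c₀ : ℝ, ∀ c' : ℝ, c₀ ≤ c' → InClassMeanPiece c' →
      ∀ (f f' g g' : ℝ → ℂ), InClassPiece f f' → InClassPiece g g' → BinomShortPairs f f' g g' → ∀ ε : ℝ, 0 < ε →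
        ForAllLarge fun D _ χ => AssumptionA D χ →
          ‖(GammaFactor.tau χ)⁻¹ * tauTwoLoweredSum c' χ g f‖ ≤ ε * frakA χ * frakP D) :
    ∃ c₀ : ℝ, ∀ c' : ℝ, c₀ ≤ c' → TauTwoDarkShort c' :=
  crossTablePsiOn_short_two_zero_eventually_of_lowered_binom_piece hK0 hlow

/-- **PORT (all short pairs, no binomial reduction):** `InClassSideTablesPiece` + ⟨lowered darkness on `ShortPairs` for all
large `c′`, given the repaired K0 at `c′`⟩ ⇒ `∃ c₀, ∀ c′ ≥ c₀, TauTwoDarkShort c′` — the form matching DISPLAY #3 §5, whose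
proposition is stated for ALL bounded short pieces (no smoothness, no density). [cite: Zhang2022LandauSiegel, §2 Lemma 2.3 p.5, §4 Lemma 4.8 p.9, §8 (8.5) Lemma 8.1 p.16, §15 p.80] -/
theorem tauTwoDarkShort_eventually_of_lowered_short_piece
    (hK0 : ∃ c₀ : ℝ, ∀ c' : ℝ, c₀ ≤ c' → InClassMeanPiece c')
    (hlow : ∃ c₀ : ℝ, ∀ c' : ℝ, c₀ ≤ c' → InClassMeanPiece c' →
      ∀ (f f' g g' : ℝ → ℂ), InClassPiece f f' → InClassPiece g g' → ShortPairs f f' g g' → ∀ ε : ℝ, 0 < ε →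
        ForAllLarge fun D _ χ => AssumptionA D χ →
          ‖(GammaFactor.tau χ)⁻¹ * tauTwoLoweredSum c' χ g f‖ ≤ ε * frakA χ * frakP D) :
    ∃ c₀ : ℝ, ∀ c' : ℝ, c₀ ≤ c' → TauTwoDarkShort c' := by
  obtain ⟨c₁, h₁⟩ := hK0
  obtain ⟨c₂, h₂⟩ := crossTablePsiOn_two_zero_eventually_of_lowered hlow
  exact ⟨max c₁ c₂, fun c' hc' =>
    h₂ c' (le_trans (le_max_right _ _) hc') (h₁ c' (le_trans (le_max_left _ _) hc'))⟩

end Ports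

end Literature.NumberTheory.LFunctions.Zhang2022.KnifeEdge

end
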